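import Mathlib
import Summits.Ventures.HodgeRepro.Tier4.Target
import Summits.Ventures.HodgeRepro.Tier4.Line3.Defs
import Summits.Ventures.HodgeRepro.Tier4.Line3.LocaliserS
import Summits.Ventures.HodgeRepro.Tier4.Line3.Witness.Coercive
import Summits.Ventures.HodgeRepro.Tier4.Line3.Witness.ThetaDataWitnessCf
import Summits.Ventures.HodgeRepro.Tier4.Line3.GrowthInvOfGauss
import Summits.Ventures.HodgeRepro.Tier4.Line3.HeckeMassBounds

/-!
# Tier4/Line3/Witness/SlotGaussWitness — the R4 witness of the coefficient functions satisfies (cf-G)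

Blind re-derivation cell `pub-hodge-repro`, Tier 4 «PROVE THE STEP» (README §9–§10), LINE L3, seat t4-L2-p1 g2.

The growth interface of the invariant route of L3.5 displays the DATA clause (cf-G) `SlotGauss D` — the slot coefficient
functions bounded by a constant times the product of the definite Gaussians, with no polynomial factor at `τ₀`
(HeckeMassBounds p676714; `GaussGrowth` / `GrowthInv` follow from it and the size clause of the localiser,
GaussGrowthOfSize p677000).  REALISABILITY (the R4 discipline, lead S12285 / S12338: every interface a line quantifies
over is witnessed): the cf-side witness `cfW` of t4-L2-p2's `Witness/ThetaDataWitnessCf` (p666772) — the Gaussian of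
the definite places `gaussDef x = ∏_σ e^{−π |H_σ(σx, σx)|}` on the lines meeting the standard lattice — satisfies
(cf-G) with `C = 1` and `c₀ = c₀W = π · min_σ λ_σ`: `‖cfW j x‖ ≤ gaussDef x ≤ gaussDefAt c₀W x`, the second
inequality TERMWISE over the definite embeddings by the coercivity `λ_σ Σ‖σx_i‖² ≤ |H_σ(σx, σx)|` (`lamAll_spec`).  So
any `ThetaData` whose coefficient functions are `cfW` has `SlotGauss` (`slotGauss_of_cf_eq_cfW`); the clause is not
vacuous on the witness side.  Nothing here asserts anything about the truth of (P); HC_CM is NOT proved by anyone in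
this repository.
-/

set_option autoImplicit false

noncomputable section

namespace Summit.Ventures.HodgeRepro.Tier4.Line3

open Summit.Ventures.HodgeRepro.Tier4
open Matrix NumberField
open scoped ComplexConjugate

namespace T4Data

variable (X : T4Data)

/-- `‖cfW j x‖ ≤ gaussDef x` (the witness is the Gaussian or `0`). -/
theorem norm_cfW_le_gaussDef (j : Fin 4) (x : Fin 3 → X.E) : ‖X.cfW j x‖ ≤ X.gaussDef x := by
  unfold cfW
  split_ifs
  · rw [Complex.norm_real, Real.norm_eq_abs, abs_of_pos (X.gaussDef_pos x)]
  · rw [norm_zero]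
    exact (X.gaussDef_pos x).le

open scoped Classical in
/-- `gaussDef` as a `Finset` product over the definite embeddings (local helper; t4-L2-p3 g3's `gaussDef_eq_prod`
of CoefMajorantWitness is the public copy). -/
private theorem gaussDef_eq_prod_aux (x : Fin 3 → X.E) :
    X.gaussDef x = ∏ σ ∈ Finset.univ.filter (fun σ : X.E →+* ℂ => σ ≠ X.τ₀ ∧ σ ≠ conjEmb X.τ₀),
      Real.exp (-(Real.pi * |(star (fun i => σ (x i)) ⬝ᵥ ((X.H.map σ) *ᵥ (fun i => σ (x i)))).re|)) := by
  unfold gaussDef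
  exact finprod_cond_eq_prod_of_cond_iff _ fun {σ} _ => by simp

/-- **The Gaussian of the definite places is dominated by the Euclidean Gaussian at `c₀W`**, termwise over the
definite embeddings (coercivity `lamAll_spec`, `c₀W ≤ π λ_σ`). -/
theorem gaussDef_le_gaussDefAt (x : Fin 3 → X.E) : X.gaussDef x ≤ X.gaussDefAt X.c₀W x := by
  classical
  rw [X.gaussDef_eq_prod_aux, X.gaussDefAt_eq_prod]
  refine Finset.prod_le_prod (fun σ _ => (Real.exp_pos _).le) fun σ hσ => ?_
  rw [Finset.mem_filter] at hσ
  rw [Real.exp_le_exp, neg_le_neg_iff]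
  calc X.c₀W * ∑ i, ‖σ (x i)‖ ^ 2 ≤ Real.pi * X.lamAll σ * ∑ i, ‖σ (x i)‖ ^ 2 := by
        gcongr
        exact X.c₀W_le σ
    _ = Real.pi * (X.lamAll σ * ∑ i, ‖σ (x i)‖ ^ 2) := by ring
    _ ≤ Real.pi * |(star (fun i => σ (x i)) ⬝ᵥ ((X.H.map σ) *ᵥ (fun i => σ (x i)))).re| := by
        gcongr
        exact X.lamAll_spec σ hσ.2.1 hσ.2.2 _

/-- **THE WITNESS SATISFIES (cf-G)**: `‖cfW j x‖ ≤ 1 · gaussDefAt c₀W x` for every slot and every vector. -/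
theorem cfW_slotGauss (j : Fin 4) (x : Fin 3 → X.E) : ‖X.cfW j x‖ ≤ 1 * X.gaussDefAt X.c₀W x := by
  rw [one_mul]
  exact (X.norm_cfW_le_gaussDef j x).trans (X.gaussDef_le_gaussDefAt x)

/-- Any identification data whose coefficient functions are the witness `cfW` satisfy `SlotGauss`. -/
theorem slotGauss_of_cf_eq_cfW (D : X.ThetaData) (hD : D.cf = X.cfW) : X.SlotGauss D :=
  ⟨1, X.c₀W, X.c₀W_pos, fun j x => by rw [hD]; exact X.cfW_slotGauss j x⟩

end T4Data

end Summit.Ventures.HodgeRepro.Tier4.Line3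

end
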